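import Literature.NumberTheory.Automorphic.ArchTorusOrbitalFunctionCompact   -- ★-pending p838154 (this seat): `continuous_integral_descConj_circleDiagonal` etc.
import Literature.NumberTheory.Automorphic.ArchTorusRegularDense            -- ★ p838161 (p02): `isOpen_setOf_injective`
import Mathlib.Analysis.SpecialFunctions.Complex.Circle
import HarnessLib

/-!
# One-parameter curves in the torus `(S¹)^N` and Rogawski's curve `γ(ψ) = (z₀e^{iψ}, z₁, z₀e^{−iψ})` through a split-singular point: smooth coordinates,
# `D_H(γ(ψ)) = |2 sin ψ|`, regular for small `ψ ≠ 0`, `γ → γ₀` through the regular set (road D2′ gap (V4); Rogawski 1990 §8.2 pp. 122–123)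

Topic `NumberTheory/Automorphic`; namespaces `Literature.NumberTheory.Automorphic` (§§1–2, the torus `(S¹)^N`) and `….UnitaryGroup` (§3, a definite place).
THEOREMS ONLY (no `def`, no instance, no notation, no axiom, no `sorry`); the curve is the bare term `fun ψ i => z₀ i * Circle.exp (c i * ψ)`.  Cell `pub/hodgecm-mathlib`,
ENGINE T1 (crux H413 = `stmt-HodgeConjecture-24833`); floor-1 preparation, count-neutral, under books rows #111 (S-d) ∕ #88 (ST-∞) (F0P3a-p02 (g8)'s CENSUS-D2prime-HClimit
§4 gap (V4) «ONE-ANGLE DERIVATIVE: the curve moving ONE pair of eigenvalues at ONE place (Rogawski's `ψ`)»); author F0P3a-p06 (g9) (BID 2026-08-31T23:47Z), over ★ D1′b,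
★ p838154 `ArchTorusOrbitalFunctionCompact` (this seat) and ★ p838161 `ArchTorusRegularDense` (p02).

WHAT IS PROVED.
* §1 (any `N`, base point `z₀ ∈ (S¹)^N`, real weights `c`): `continuous_torusCurve`, `torusCurve_zero`, `coe_torusCurve`, **`hasDerivAt_coe_torusCurve`** (the complex
  coordinates `ψ ↦ z₀_i e^{i c_i ψ}` are differentiable with the expected derivative), `norm_exp_mul_I_sub_exp_neg_mul_I` (`|e^{ia} − e^{−ia}| = 2|sin a|`),
  **`norm_coe_torusCurve_sub_of_neg`** (an opposite pair `z₀_i = z₀_j`, `c_j = −c_i` has `|γ(ψ)_i − γ(ψ)_j| = 2|sin(c_i ψ)|`).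
* §2 (Rogawski's split curve, `N = 3`, `c = (1, 0, −1)`, base point with `z₀ 0 = z₀ 2`): `splitCurve_apply_one` (the middle coordinate is fixed),
  **`norm_coe_splitCurve_zero_sub_two`** («`D_H(γ) = |2 sin ψ|`», p. 123), `splitCurve_apply_zero_ne_apply_two` (`0 < |ψ| < π` ⇒ the moving pair is distinct),
  **`eventually_injective_splitCurve`** (`z₀ 0 = z₀ 2 ≠ z₀ 1` ⇒ `γ(ψ)` is REGULAR for all small `ψ ≠ 0`), **`tendsto_splitCurve_nhdsWithin_injective`**
  (`γ → z₀` as `ψ → 0, ψ ≠ 0` THROUGH the regular set — the filter in which the limit formulas are stated; `γ(0) = z₀` is the split-singular point of ★ (V9)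
  `centralizer_circleDiagonal_eq_range_endoEmb`).
* §3 (a definite place, `G_w` compact): **`continuous_integral_descConj_torusCurve`** — `ψ ↦ F_f(γ(ψ))` is continuous on all of `ℝ` (★ p838154 ∘ §1).
NOT HERE: differentiability of `ψ ↦ F_f(γ(ψ))` and the limit of `∂_ψ (2 sin ψ · F)` — that IS the rank-one limit formula (letter (L-H), floor 2).
HONEST LABEL: HC_CM is proved only modulo the printed citations until rung 0 closes; this file pays nothing by itself.

## References
* [Rogawski1990] J. D. Rogawski, *Automorphic Representations of Unitary Groups in Three Variables*, Ann. of Math. Stud. 123 (1990): §8.2 pp. 122–123 (the compact Cartan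
  `γ(θ, φ, ψ)`, `γ₀ = γ(θ, φ, 0)`, `D_H(γ) = |2 sin ψ|`), §14.5 p. 238 («let `γ′` approach `γ₀`»).
* [Shelstad1979] D. Shelstad, *Characters and inner forms of a quasi-split group over `ℝ`*, Compositio Math. 39 (1979), §4.
-/

set_option autoImplicit false

noncomputable section

open MeasureTheory Measure NumberField NumberField.InfinitePlace Filter Topology Complex
open Literature.MeasureTheory.Group
open scoped Matrix MatrixGroups Real

namespace Literature.NumberTheory.Automorphic

/-! ## §1 One-parameter curves `ψ ↦ (z₀_i · e^{i c_i ψ})_i` in the torus `(S¹)^N` -/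

section Curve

variable {N : ℕ} (z₀ : Fin N → Circle) (c : Fin N → ℝ)

/-- The curve is continuous in `ψ` (Mathlib `Circle.exp : C(ℝ, S¹)`). [cite: Rogawski1990, §8.2 p. 122] -/
theorem continuous_torusCurve : Continuous fun ψ : ℝ => fun i => z₀ i * Circle.exp (c i * ψ) :=
  continuous_pi fun _ => continuous_const.mul (Circle.exp.continuous.comp (continuous_const.mul continuous_id))

/-- At `ψ = 0` the curve is at `z₀`. [cite: Rogawski1990, §8.2 p. 122] -/
theorem torusCurve_zero : (fun i => z₀ i * Circle.exp (c i * 0)) = z₀ := by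
  funext i; rw [mul_zero, Circle.exp_zero, mul_one]

/-- The complex coordinates of the curve: `z₀_i · exp(i c_i ψ)`. [cite: Rogawski1990, §8.2 p. 122] -/
theorem coe_torusCurve (i : Fin N) (ψ : ℝ) :
    ((z₀ i * Circle.exp (c i * ψ) : Circle) : ℂ) = (z₀ i : ℂ) * Complex.exp ((c i * ψ : ℝ) * I) := by
  rw [Circle.coe_mul, Circle.coe_exp]

/-- **The coordinates are differentiable in `ψ`** with derivative `z₀_i · (i c_i) · exp(i c_i ψ)` (so every composite with a smooth function of the torus coordinates is
differentiable; the letters differentiate `D^{1∕2}·Φ` along this curve). [cite: Rogawski1990, §8.2 p. 123] -/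
theorem hasDerivAt_coe_torusCurve (i : Fin N) (ψ : ℝ) :
    HasDerivAt (fun ψ : ℝ => ((z₀ i * Circle.exp (c i * ψ) : Circle) : ℂ))
      ((z₀ i : ℂ) * (Complex.exp ((c i * ψ : ℝ) * I) * ((c i : ℂ) * I))) ψ := by
  simp_rw [coe_torusCurve]
  refine HasDerivAt.const_mul _ ?_
  have h1 : HasDerivAt (fun ψ : ℝ => ((c i * ψ : ℝ) : ℂ) * I) ((c i : ℂ) * I) ψ := by
    have h0 : HasDerivAt (fun ψ : ℝ => ((c i * ψ : ℝ) : ℂ)) (c i : ℂ) ψ := by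
      simpa using ((hasDerivAt_id ψ).const_mul (c i)).ofReal_comp
    simpa using h0.mul_const I
  exact (Complex.hasDerivAt_exp _).comp ψ h1

/-- `|e^{ia} − e^{−ia}| = 2|sin a|` — the elementary identity behind print's `D_H(γ(ψ)) = |2 sin ψ|`. [cite: Rogawski1990, §8.2 p. 123] -/
theorem norm_exp_mul_I_sub_exp_neg_mul_I (a : ℝ) : ‖Complex.exp (a * I) - Complex.exp (-(a : ℂ) * I)‖ = 2 * |Real.sin a| := by
  have h : Complex.exp (a * I) - Complex.exp (-(a : ℂ) * I) = 2 * Real.sin a * I := by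
    rw [show (-(a : ℂ)) = ((-a : ℝ) : ℂ) by push_cast; ring, exp_mul_I, exp_mul_I, ← Complex.ofReal_cos, ← Complex.ofReal_sin,
      ← Complex.ofReal_cos, ← Complex.ofReal_sin, Real.cos_neg, Real.sin_neg]
    push_cast; ring
  rw [h, norm_mul, norm_mul, Complex.norm_I, mul_one, Complex.norm_real, Real.norm_eq_abs, Complex.norm_ofNat]

/-- **`D`-factor of an OPPOSITE pair along the curve**: if `z₀_i = z₀_j` and `c_j = −c_i` then `|γ(ψ)_i − γ(ψ)_j| = 2|sin(c_i ψ)|` — for Rogawski's pair `{e₁, e₃}` with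
`c = (1, 0, −1)` this is «`D_H(γ) = |2 sin ψ|`». [cite: Rogawski1990, §8.2 p. 123] -/
theorem norm_coe_torusCurve_sub_of_neg {i j : Fin N} (hz : z₀ i = z₀ j) (hc : c j = -c i) (ψ : ℝ) :
    ‖((z₀ i * Circle.exp (c i * ψ) : Circle) : ℂ) - ((z₀ j * Circle.exp (c j * ψ) : Circle) : ℂ)‖ = 2 * |Real.sin (c i * ψ)| := by
  rw [coe_torusCurve, coe_torusCurve, ← hz, hc, ← mul_sub, norm_mul, Circle.norm_coe, one_mul,
    show (((-c i) * ψ : ℝ) : ℂ) * I = -((c i * ψ : ℝ) : ℂ) * I by push_cast; ring]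
  exact norm_exp_mul_I_sub_exp_neg_mul_I _

end Curve

/-! ## §2 Rogawski's curve through a SPLIT-SINGULAR point of `(S¹)³`: `γ(ψ) = (z₀ e^{iψ}, z₁, z₀ e^{−iψ})`, `z₀ ≠ z₁` -/

section Split

variable (z₀ : Fin 3 → Circle)

/-- The split weights `c = (1, 0, −1)` (the pair `{e₁, e₃}` moves, `e₂` is fixed). [cite: Rogawski1990, §8.2 p. 122] -/
theorem splitWeights_apply : (![(1 : ℝ), 0, -1] 0 = 1) ∧ (![(1 : ℝ), 0, -1] 1 = 0) ∧ (![(1 : ℝ), 0, -1] 2 = -1) := ⟨rfl, rfl, rfl⟩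

/-- The middle coordinate of the split curve is constant: `γ(ψ)₁ = z₀ 1`. [cite: Rogawski1990, §8.2 p. 122] -/
theorem splitCurve_apply_one (ψ : ℝ) : z₀ 1 * Circle.exp (![(1 : ℝ), 0, -1] 1 * ψ) = z₀ 1 := by
  rw [show ![(1 : ℝ), 0, -1] 1 = 0 from rfl, zero_mul, Circle.exp_zero, mul_one]

/-- **`D_H(γ(ψ)) = |2 sin ψ|`** along the split curve (the pair `{e₁,e₃}`), when `z₀ 0 = z₀ 2`. [cite: Rogawski1990, §8.2 p. 123] -/
theorem norm_coe_splitCurve_zero_sub_two (h02 : z₀ 0 = z₀ 2) (ψ : ℝ) :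
    ‖((z₀ 0 * Circle.exp (![(1 : ℝ), 0, -1] 0 * ψ) : Circle) : ℂ) - ((z₀ 2 * Circle.exp (![(1 : ℝ), 0, -1] 2 * ψ) : Circle) : ℂ)‖ =
      2 * |Real.sin ψ| := by
  rw [norm_coe_torusCurve_sub_of_neg z₀ ![(1 : ℝ), 0, -1] h02 (by simp) ψ, show ![(1 : ℝ), 0, -1] 0 = 1 from rfl, one_mul]

/-- For `0 < |ψ| < π` the two moving coordinates are DISTINCT: `z₀ e^{iψ} ≠ z₀ e^{−iψ}`. [cite: Rogawski1990, §8.2 p. 122] -/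
theorem splitCurve_apply_zero_ne_apply_two (h02 : z₀ 0 = z₀ 2) {ψ : ℝ} (hψ : ψ ≠ 0) (hψπ : |ψ| < π) :
    z₀ 0 * Circle.exp (![(1 : ℝ), 0, -1] 0 * ψ) ≠ z₀ 2 * Circle.exp (![(1 : ℝ), 0, -1] 2 * ψ) := by
  intro h
  have hn := norm_coe_splitCurve_zero_sub_two z₀ h02 ψ
  rw [h, sub_self, norm_zero] at hn
  have hs : Real.sin ψ = 0 := by
    have : |Real.sin ψ| = 0 := by linarith
    exact abs_eq_zero.mp this
  -- `sin ψ = 0` with `|ψ| < π` forces `ψ = 0`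
  rcases lt_or_gt_of_ne hψ with hlt | hgt
  · have : Real.sin ψ < 0 := Real.sin_neg_of_neg_of_neg_pi_lt hlt (by linarith [neg_abs_le ψ, abs_of_neg hlt])
    linarith
  · have : 0 < Real.sin ψ := Real.sin_pos_of_pos_of_lt_pi hgt (by linarith [le_abs_self ψ])
    linarith

/-- **The split curve is REGULAR for all small `ψ ≠ 0`**: if `z₀ 0 = z₀ 2 ≠ z₀ 1` (a split-singular point, ★ `centralizer_circleDiagonal_eq_range_endoEmb`) then
`γ(ψ)` has pairwise-distinct coordinates for every `ψ ≠ 0` near `0` — «let `γ` approach `γ₀` through regular elements». [cite: Rogawski1990, §8.2 p. 122; §14.5 p. 238] -/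
theorem eventually_injective_splitCurve (h02 : z₀ 0 = z₀ 2) (h01 : z₀ 0 ≠ z₀ 1) :
    ∀ᶠ ψ in 𝓝[≠] (0 : ℝ), Function.Injective fun i => z₀ i * Circle.exp (![(1 : ℝ), 0, -1] i * ψ) := by
  -- the two open conditions `γ(ψ)₀ ≠ z₀ 1`, `γ(ψ)₂ ≠ z₀ 1` hold near `0`, and `|ψ| < π`
  have hc := continuous_torusCurve z₀ ![(1 : ℝ), 0, -1]
  have h0 : ∀ᶠ ψ in 𝓝 (0 : ℝ), z₀ 0 * Circle.exp (![(1 : ℝ), 0, -1] 0 * ψ) ≠ z₀ 1 * Circle.exp (![(1 : ℝ), 0, -1] 1 * ψ) := by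
    have hopen : IsOpen {z : Fin 3 → Circle | z 0 ≠ z 1} := isOpen_ne_fun (continuous_apply 0) (continuous_apply 1)
    have hmem : (fun i => z₀ i * Circle.exp (![(1 : ℝ), 0, -1] i * (0 : ℝ))) ∈ {z : Fin 3 → Circle | z 0 ≠ z 1} := by
      rw [torusCurve_zero]; exact h01
    exact hc.continuousAt.eventually (hopen.mem_nhds hmem)
  have h2 : ∀ᶠ ψ in 𝓝 (0 : ℝ), z₀ 2 * Circle.exp (![(1 : ℝ), 0, -1] 2 * ψ) ≠ z₀ 1 * Circle.exp (![(1 : ℝ), 0, -1] 1 * ψ) := by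
    have hopen : IsOpen {z : Fin 3 → Circle | z 2 ≠ z 1} := isOpen_ne_fun (continuous_apply 2) (continuous_apply 1)
    have hmem : (fun i => z₀ i * Circle.exp (![(1 : ℝ), 0, -1] i * (0 : ℝ))) ∈ {z : Fin 3 → Circle | z 2 ≠ z 1} := by
      rw [torusCurve_zero]; exact fun h => h01 (h02.trans h)
    exact hc.continuousAt.eventually (hopen.mem_nhds hmem)
  have hπ : ∀ᶠ ψ in 𝓝 (0 : ℝ), |ψ| < π := by
    have : IsOpen {ψ : ℝ | |ψ| < π} := isOpen_lt continuous_abs continuous_const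
    exact this.mem_nhds (by simp [Real.pi_pos])
  have hne : ∀ᶠ ψ in 𝓝[≠] (0 : ℝ), ψ ≠ 0 := self_mem_nhdsWithin
  filter_upwards [nhdsWithin_le_nhds h0, nhdsWithin_le_nhds h2, nhdsWithin_le_nhds hπ, hne] with ψ hψ0 hψ2 hψπ hψne
  have h02' := splitCurve_apply_zero_ne_apply_two z₀ h02 hψne hψπ
  intro i j hij
  fin_cases i <;> fin_cases j
  · rfl
  · exact absurd hij hψ0
  · exact absurd hij h02'
  · exact absurd hij.symm hψ0
  · rfl
  · exact absurd hij.symm hψ2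
  · exact absurd hij.symm h02'
  · exact absurd hij hψ2
  · rfl

/-- **The split curve tends to `z₀` THROUGH THE REGULAR SET** as `ψ → 0`, `ψ ≠ 0` (the filter statement the limit formulas are phrased in; the regular set is open and
dense, ★ `isOpen_setOf_injective`, ★ `dense_setOf_injective`). [cite: Rogawski1990, §8.2 p. 122; §14.5 p. 238] -/
theorem tendsto_splitCurve_nhdsWithin_injective (h02 : z₀ 0 = z₀ 2) (h01 : z₀ 0 ≠ z₀ 1) :
    Tendsto (fun ψ : ℝ => fun i => z₀ i * Circle.exp (![(1 : ℝ), 0, -1] i * ψ)) (𝓝[≠] 0)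
      (𝓝[{z : Fin 3 → Circle | Function.Injective z}] z₀) := by
  refine tendsto_nhdsWithin_iff.mpr ⟨?_, eventually_injective_splitCurve z₀ h02 h01⟩
  have h := (continuous_torusCurve z₀ ![(1 : ℝ), 0, -1]).tendsto 0
  rw [torusCurve_zero] at h
  exact h.mono_left nhdsWithin_le_nhds

end Split

/-! ## §3 At a definite place: the torus orbital function along the curve is continuous in `ψ` -/

namespace UnitaryGroup

section Place

variable (L : Type) [Field L] (N : ℕ) (α : Fin N → L) (w : {w : InfinitePlace L // IsComplex w})
  [CompactSpace (archLocal L N (Matrix.diagonal α) w)]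
  [LocallyCompactSpace (archLocal L N (Matrix.diagonal α) w)] [SecondCountableTopology (archLocal L N (Matrix.diagonal α) w)]
  [MeasurableSpace (archLocal L N (Matrix.diagonal α) w)] [BorelSpace (archLocal L N (Matrix.diagonal α) w)]
  (ν : Measure (archLocal L N (Matrix.diagonal α) w)) [ν.IsHaarMeasure] [ν.IsMulRightInvariant]
  (tT : Measure ((circleDiagonal N).range.subgroupOf (archLocal L N (Matrix.diagonal α) w))) [tT.IsHaarMeasure] [tT.IsInvInvariant]
  [MeasurableSpace (archLocal L N (Matrix.diagonal α) w ⧸ (circleDiagonal N).range.subgroupOf (archLocal L N (Matrix.diagonal α) w))]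
  [BorelSpace (archLocal L N (Matrix.diagonal α) w ⧸ (circleDiagonal N).range.subgroupOf (archLocal L N (Matrix.diagonal α) w))]
  {E : Type*} [NormedAddCommGroup E] [NormedSpace ℝ E]

/-- **At a definite place `ψ ↦ F_f(γ(ψ))` is continuous on all of `ℝ`** (through the singular value `ψ = 0`), for ANY base point `z₀` and weights `c`
(★ `continuous_integral_descConj_circleDiagonal` ∘ `continuous_torusCurve`). [cite: Rogawski1990, §14.5 p. 238] [cite: Shelstad1979, §4] -/
theorem continuous_integral_descConj_torusCurve (z₀ : Fin N → Circle) (c : Fin N → ℝ)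
    (f : archLocal L N (Matrix.diagonal α) w → E) (hf : Continuous f) :
    Continuous fun ψ : ℝ =>
      ∫ y, descConj (⟨circleDiagonal N (fun i => z₀ i * Circle.exp (c i * ψ)),
          circleDiagonal_mem_archLocal_diagonal L N α w _⟩ : archLocal L N (Matrix.diagonal α) w)
        ((circleDiagonal N).range.subgroupOf (archLocal L N (Matrix.diagonal α) w)) (circleTorus_comm_circleDiagonal L N α w _) f y
        ∂(quotientMeasure _ tT (isClosed_circleTorus L N α w) ν) :=
  (continuous_integral_descConj_circleDiagonal L N α w ν tT f hf).comp (continuous_torusCurve z₀ c)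

end Place

end UnitaryGroup

end Literature.NumberTheory.Automorphic
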